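/-
Copyright (c) 2026 the pub-hodgecm-mathlib formalisation cell (harness21).  Prover seat hodgecm-mathlib-LH10-p01 (g12): road M6 → F5 → dyadic chain of `stub_DyUnramCore` (D-UNR),
brick (U)-dy «THE FINITE-GROUP ROOT, 2-FREE» part 2∕3 — Jordan rank classifies the unipotent classes of `U₃(𝔽_q)` for EVERY `q`; 2026-09-03.
-/
import Literature.GroupTheory.SpecificGroups.FiniteUnitaryThreeUnipotentJordanClasses   -- ★ (F0P3a-p06): §1 rank dictionary, §2 transvections (`exists_conj_eq_of_sq_eq_zero_of_norm_surjective`, `exists_norm_eq_of_frob`), §4 transport (`exists_formCongr_antidiag_eq`); the `2 ≠ 0` originals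
import Literature.NumberTheory.Automorphic.UnitaryThreeRegularUnipotentClassOfTraceOne     -- ★-to-be (this seat, part 1∕3): Prop. 3.9.1 under `θ + σθ = 1`
import Literature.FieldTheory.FiniteFields.QuadraticTraceKernelCount                        -- ★ `exists_trace_eq` (the trace `𝔽_{q²} → 𝔽_q` is onto)
import HarnessLib

/-!
# Jordan rank classifies the unipotent classes of `U₃(𝔽_q)` in EVERY characteristic (Wilson, *The Finite Simple Groups*, §3.6.1; Rogawski 1990, §3.9, Prop. 3.9.1)

Topic `Literature/GroupTheory/SpecificGroups`; namespace `Literature.GroupTheory.SpecificGroups`.  THEOREMS ONLY (no definition, no named fact, no instance, no notation, no `sorry`);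
kernel lane `--supports stmt-HodgeConjecture-24833`.  Cell `pub/hodgecm-mathlib` (D-0151), crux H413 = `stmt-HodgeConjecture-24833`; road M6 → F5 → the dyadic chain of organ (D-UNR)
`stub_DyUnramCore`: ★ `FiniteUnitaryThreeUnipotentJordanClasses` §3∕§4 (`exists_conj_eq_of_rank_sub_one_eq(_of_hermitian)`, `eq_of_conj_invariant_of_rank_eq(_of_hermitian)`) carry
`h2 : (2 : k) ≠ 0` ONLY to call ★ Prop. 3.9.1; with part 1∕3 (Prop. 3.9.1 under `∃ θ, θ + σθ = 1`) and ★ `FiniteFields.exists_trace_eq` (`σ = Frob_q` ⇒ some `θ` has `σθ + θ = 1`),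
the same four statements hold for EVERY `q`, the characteristic-2 fields `𝔽_{2^{2r}}` included — which is what the DYADIC places `v ∣ 2` of `L⁺` (residue field `𝔽_{2^r}`,
`𝓀_w = 𝔽_{2^{2r}}`) present to the strata-constancy steps (U) and (L2-int) of the identity core.  Proofs: ★ §3∕§4 verbatim with the last line re-sourced.
HONEST LABEL: HC_CM is proved only modulo the 7 printed citations (2 remaining named inputs: hLiu418 = stmt-HodgeConjecture-24832, h413 = stmt-HodgeConjecture-24833) until rung 0
closes; elementary, count-neutral (zero label movement until the desk prices the `stub_N6nsDyadic` rider).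

THE PRINT ([Wilson2009, §3.6.1 p. 67]; [Rogawski1990, §3.9 p. 32, Prop. 3.9.1]) has no parity hypothesis: in `GU₃(q)` the unipotent classes are the three partitions `(1³), (2,1), (3)`
for every `q`.

* `exists_add_frob_eq_one` — `∃ θ, θ + σθ = 1` on `𝔽_{q²}`;
* **`exists_conj_eq_of_rank_sub_one_eq_anyChar`**, `eq_of_conj_invariant_of_rank_eq_anyChar` (split form `J₀`);
* **`exists_conj_eq_of_rank_sub_one_eq_of_hermitian_anyChar`**, **`eq_of_conj_invariant_of_rank_eq_of_hermitian_anyChar`** (any non-degenerate hermitian `J`).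

## References
* [Wilson2009] R. A. Wilson, *The Finite Simple Groups*, GTM 251 (2009): §3.6.1 p. 67, §3.6.2 p. 68.
* [Rogawski1990] J. D. Rogawski, *Automorphic Representations of Unitary Groups in Three Variables*, Ann. of Math. Stud. 123 (1990): §3.9 p. 32, Proposition 3.9.1.
* [LidlNiederreiter1996] R. Lidl, H. Niederreiter, *Finite Fields*, 2nd ed. (1997): Thm. 2.23 (iii) (the trace is onto).
-/

set_option autoImplicit false

noncomputable section

open Matrix Module Literature.FieldTheory.FiniteFields Literature.NumberTheory.Automorphic
open Literature.NumberTheory.Automorphic.HermitianLattice Literature.NumberTheory.Automorphic.UnitaryGroup Literature.LinearAlgebra.Matrix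

namespace Literature.GroupTheory.SpecificGroups

section Finite

variable {k : Type*} [Field k] [Fintype k] {q : ℕ}

/-- **`𝔽_{q²}` holds an element of trace one**: `σ = Frob_q ⇒ ∃ θ, θ + σθ = 1` (★ `exists_trace_eq` at `e = 1`). [cite: LidlNiederreiter1996, Thm. 2.23 (iii)] -/
theorem exists_add_frob_eq_one (hk : Fintype.card k = q ^ 2) (σ : k →+* k) (hσ : ∀ x, σ x = x ^ q) : ∃ θ : k, θ + σ θ = 1 := by
  obtain ⟨t, ht⟩ := exists_trace_eq hk σ hσ (map_one σ)
  exact ⟨t, by rw [add_comm]; exact ht⟩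

/-- **MAIN — Jordan rank classifies the unipotent classes of `U₃(𝔽_q)`, EVERY `q`**: in `U(σ, J₀)` over `k` with `#k = q²`, `σ = Frob_q`, two unipotent elements `u, u′` with
`rank(u − 1) = rank(u′ − 1)` are conjugate by an element of `U(σ, J₀)`.  ★ `exists_conj_eq_of_rank_sub_one_eq` verbatim, the regular class re-sourced from part 1∕3
`exists_conj_eq_of_regular_unipotent_of_add_map_eq_one` at `θ` of `exists_add_frob_eq_one`. [cite: Rogawski1990, §3.9 p. 32, Prop. 3.9.1] [cite: Wilson2009, §3.6.1 p. 67] -/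
theorem exists_conj_eq_of_rank_sub_one_eq_anyChar (hk : Fintype.card k = q ^ 2) (σ : k →+* k) (hσ : ∀ x, σ x = x ^ q)
    {u u' : GL (Fin 3) k} (hu : u ∈ unitaryGroupOfForm σ ((StdForm.antidiagonal 3).over k))
    (hu' : u' ∈ unitaryGroupOfForm σ ((StdForm.antidiagonal 3).over k))
    (hnil : IsNilpotent ((u : Matrix (Fin 3) (Fin 3) k) - 1)) (hnil' : IsNilpotent ((u' : Matrix (Fin 3) (Fin 3) k) - 1))
    (hrank : ((u : Matrix (Fin 3) (Fin 3) k) - 1).rank = ((u' : Matrix (Fin 3) (Fin 3) k) - 1).rank) :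
    ∃ g : GL (Fin 3) k, g ∈ unitaryGroupOfForm σ ((StdForm.antidiagonal 3).over k) ∧ g * u * g⁻¹ = u' := by
  have hσσ := frob_frob hk σ hσ
  obtain ⟨θ, hθ⟩ := exists_add_frob_eq_one hk σ hσ
  have one_of : ∀ {w : GL (Fin 3) k}, (w : Matrix (Fin 3) (Fin 3) k) - 1 = 0 → w = 1 := fun h =>
    Units.ext (by rw [Units.val_one]; exact sub_eq_zero.1 h)
  by_cases h0 : (u : Matrix (Fin 3) (Fin 3) k) - 1 = 0
  · -- rank 0: both are the identity
    have h0' : (u' : Matrix (Fin 3) (Fin 3) k) - 1 = 0 := by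
      rw [← rank_eq_zero_iff_eq_zero, ← hrank, h0, Matrix.rank_zero]
    refine ⟨1, Subgroup.one_mem _, ?_⟩
    rw [one_of h0, one_of h0']; group
  by_cases hsq : ((u : Matrix (Fin 3) (Fin 3) k) - 1) * ((u : Matrix (Fin 3) (Fin 3) k) - 1) = 0
  · -- rank 1: transvections
    have h1 : ((u' : Matrix (Fin 3) (Fin 3) k) - 1).rank = 1 := by rw [← hrank]; exact rank_eq_one_of_sq_eq_zero hsq h0
    obtain ⟨h0', hsq'⟩ := (rank_eq_one_iff_of_isNilpotent hnil').1.1 h1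
    exact exists_conj_eq_of_sq_eq_zero_of_norm_surjective σ hσσ (fun e he he0 => exists_norm_eq_of_frob hk σ hσ he he0) hu hu' hsq hsq'
      (fun h => h0 (by rw [h, Units.val_one, sub_self])) (fun h => h0' (by rw [h, Units.val_one, sub_self]))
  · -- rank 2: regular unipotents, Prop. 3.9.1 in every characteristic
    have h2r : ((u' : Matrix (Fin 3) (Fin 3) k) - 1).rank = 2 := by rw [← hrank]; exact rank_eq_two_of_sq_ne_zero hnil hsq
    have hsq' := (rank_eq_one_iff_of_isNilpotent hnil').2.1 h2r
    exact exists_conj_eq_of_regular_unipotent_of_add_map_eq_one σ hσσ hθ hu hu' hnil hnil' hsq hsq'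

/-- **SEAM (U), every `q`**: a function on `U(σ, J₀)` invariant under `U(σ, J₀)`-conjugation takes the same value on any two unipotent elements of equal Jordan rank.
[cite: Rogawski1990, §3.9 p. 32, Prop. 3.9.1] -/
theorem eq_of_conj_invariant_of_rank_eq_anyChar (hk : Fintype.card k = q ^ 2) (σ : k →+* k) (hσ : ∀ x, σ x = x ^ q)
    {α : Type*} (f : GL (Fin 3) k → α)
    (hf : ∀ g ∈ unitaryGroupOfForm σ ((StdForm.antidiagonal 3).over k), ∀ x ∈ unitaryGroupOfForm σ ((StdForm.antidiagonal 3).over k), f (g * x * g⁻¹) = f x)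
    {u u' : GL (Fin 3) k} (hu : u ∈ unitaryGroupOfForm σ ((StdForm.antidiagonal 3).over k))
    (hu' : u' ∈ unitaryGroupOfForm σ ((StdForm.antidiagonal 3).over k))
    (hnil : IsNilpotent ((u : Matrix (Fin 3) (Fin 3) k) - 1)) (hnil' : IsNilpotent ((u' : Matrix (Fin 3) (Fin 3) k) - 1))
    (hrank : ((u : Matrix (Fin 3) (Fin 3) k) - 1).rank = ((u' : Matrix (Fin 3) (Fin 3) k) - 1).rank) : f u = f u' := by
  obtain ⟨g, hg, hconj⟩ := exists_conj_eq_of_rank_sub_one_eq_anyChar hk σ hσ hu hu' hnil hnil' hrank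
  rw [← hconj, hf g hg u hu]

/-- **MAIN for any form, every `q`**: in `U(σ, J)`, `J ∈ M₃(𝔽_{q²})` non-degenerate `σ`-hermitian (`σ = Frob_q`), two unipotents with `rank(u − 1) = rank(u′ − 1)` are
`U(σ, J)`-conjugate (★ §4 transport along `σ(T)ᵀ J₀ T = J`, verbatim). [cite: Rogawski1990, §3.9 p. 32, Prop. 3.9.1] [cite: Wilson2009, §3.6.1 p. 67] -/
theorem exists_conj_eq_of_rank_sub_one_eq_of_hermitian_anyChar (hk : Fintype.card k = q ^ 2) (σ : k →+* k) (hσ : ∀ x, σ x = x ^ q)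
    {J : Matrix (Fin 3) (Fin 3) k} (hJ : (J.map σ)ᵀ = J) (hdet : J.det ≠ 0)
    {u u' : GL (Fin 3) k} (hu : u ∈ unitaryGroupOfForm σ J) (hu' : u' ∈ unitaryGroupOfForm σ J)
    (hnil : IsNilpotent ((u : Matrix (Fin 3) (Fin 3) k) - 1)) (hnil' : IsNilpotent ((u' : Matrix (Fin 3) (Fin 3) k) - 1))
    (hrank : ((u : Matrix (Fin 3) (Fin 3) k) - 1).rank = ((u' : Matrix (Fin 3) (Fin 3) k) - 1).rank) :
    ∃ g : GL (Fin 3) k, g ∈ unitaryGroupOfForm σ J ∧ g * u * g⁻¹ = u' := by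
  obtain ⟨T, hT⟩ := exists_formCongr_antidiag_eq hk σ hσ J hJ hdet
  -- move to `U(σ, J₀)` by `x ↦ T x T⁻¹`
  have hmem : ∀ {x : GL (Fin 3) k}, x ∈ unitaryGroupOfForm σ J → T * x * T⁻¹ ∈ unitaryGroupOfForm σ ((StdForm.antidiagonal 3).over k) := by
    intro x hx
    rw [conj_mem_unitaryGroupOfForm_iff, hT]
    exact hx
  obtain ⟨g₀, hg₀, hconj⟩ := exists_conj_eq_of_rank_sub_one_eq_anyChar hk σ hσ (hmem hu) (hmem hu')
    (isNilpotent_coe_conj_sub_one T hnil) (isNilpotent_coe_conj_sub_one T hnil') (by rw [rank_conj_sub_one, rank_conj_sub_one, hrank])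
  refine ⟨T⁻¹ * g₀ * T, ?_, ?_⟩
  · have key := (conj_mem_unitaryGroupOfForm_iff σ T ((StdForm.antidiagonal 3).over k) (T⁻¹ * g₀ * T)).1
    rw [hT] at key
    apply key
    have hg : T * (T⁻¹ * g₀ * T) * T⁻¹ = g₀ := by group
    rw [hg]
    exact hg₀
  · calc T⁻¹ * g₀ * T * u * (T⁻¹ * g₀ * T)⁻¹ = T⁻¹ * (g₀ * (T * u * T⁻¹) * g₀⁻¹) * T := by group
      _ = u' := by rw [hconj]; group

/-- **SEAM (U) for any form, every `q`**: a `U(σ, J)`-conjugation-invariant function takes equal values on unipotent elements of `U(σ, J)` of equal Jordan rank — the form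
the dyadic twins of (U) `strataConstancy_of_levelOne` and (L2-int) `interiorStrataConstancy_of_levelTwo` consume. [cite: Rogawski1990, §3.9 p. 32, Prop. 3.9.1] -/
theorem eq_of_conj_invariant_of_rank_eq_of_hermitian_anyChar (hk : Fintype.card k = q ^ 2) (σ : k →+* k) (hσ : ∀ x, σ x = x ^ q)
    {J : Matrix (Fin 3) (Fin 3) k} (hJ : (J.map σ)ᵀ = J) (hdet : J.det ≠ 0)
    {α : Type*} (f : GL (Fin 3) k → α) (hf : ∀ g ∈ unitaryGroupOfForm σ J, ∀ x ∈ unitaryGroupOfForm σ J, f (g * x * g⁻¹) = f x)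
    {u u' : GL (Fin 3) k} (hu : u ∈ unitaryGroupOfForm σ J) (hu' : u' ∈ unitaryGroupOfForm σ J)
    (hnil : IsNilpotent ((u : Matrix (Fin 3) (Fin 3) k) - 1)) (hnil' : IsNilpotent ((u' : Matrix (Fin 3) (Fin 3) k) - 1))
    (hrank : ((u : Matrix (Fin 3) (Fin 3) k) - 1).rank = ((u' : Matrix (Fin 3) (Fin 3) k) - 1).rank) : f u = f u' := by
  obtain ⟨g, hg, hconj⟩ := exists_conj_eq_of_rank_sub_one_eq_of_hermitian_anyChar hk σ hσ hJ hdet hu hu' hnil hnil' hrank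
  rw [← hconj, hf g hg u hu]

end Finite

end Literature.GroupTheory.SpecificGroups

end
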